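import Mathlib
import HarnessLib
import HarnessLib.Audit
import Summits.AtomisticToContinuum.Statement
import Literature.MathematicalPhysics.QuantumManyBody.PeriodicBoseGas

/-!
Route: BECPhononTransport

CLOSED (retired) 2026-08-15T13:39:31Z by operator:999:1257524 — reason: not-a-thesis: assembly does not conclude the sub-problem Statement — note: D-0027 §2.1 audit (human 2026-08-15: routes that do not decide the summit are removed): the assembly concludes `Literature.MathematicalPhysics.QuantumManyBody.BoseGas.BoseEinsteinCondensation`, not the sub-problem statement; a NEW conforming route may be opened from the same idea (generated `closes . The file is kept as the record of this route; refuted decls are indexed as negative knowledge (`ledger negatives`).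

# Route BECPhononTransport — far field by phonon transport paid by the f-sum rule, healing scale by
GP-scale localisation — a momentum split of the torus depletion

It suffices to show X = IRDepletionBound ∧ UVDepletionBound for near-minimisers of the PERIODIC
N-body energy on the torus of side
L = (N/ρ)^(1/3) (then PeriodicBEC with c = 1/2 by Parseval, and the shared crux BoundaryTransferWeak
of route BECPeriodicReduction carries it to
the Dirichlet conjunct). IRDepletionBound (far field): for every repulsive finite-range v there are
K₀ > 0, ρ₀ > 0 such that for 0 < ρ < ρ₀,
all large N, some δ > 0 and every δ-near-minimiser Ψ, the plane-wave occupations in the infrared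
window 0 < |p| ≤ K₀√ρ sum to ≤ N/8.
UVDepletionBound (healing scale): for every K₀ > 0, at small density the occupations with |p| > K₀√ρ
sum to ≤ N/8. The route realises card
phonon-transport-fsum: the IR half is where its mechanism lives (depletion = slice variance,
DepletionVarianceIdentity; move the Gaussian-smeared
tagged boson with the explicit dipole displacement operator, SmearedDipoleCost, whose far-field cost
is paid by the f-sum × third-moment bound
on the longitudinal force structure factor, ForceStructureFactorBound; residual = linear response,
SmearedLinearResponse; glue TransportToIR);
the UV half is handed to GP-scale localisation, which rests on PROVED cone facts
(Fournais2020_condensation_holds, LSSY2005 Thm 2.4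
periodic/Neumann, Thm 2.2, Lemma 4.1, Lemma 5.2, Thm 5.1).
Lean: `(∀ v : ℝ → ENNReal,
Literature.MathematicalPhysics.QuantumManyBody.BoseGas.IsRepulsiveFiniteRange v → ∃ K₀ : ℝ, 0 < K₀ ∧
∃ ρ₀ : ℝ, 0 < ρ₀ ∧ ∀ ρ : ℝ, 0 < ρ → ρ < ρ₀ → ∀ᶠ N : ℕ in Filter.atTop, ∃ δ : ENNReal, 0 < δ ∧ ∀ Ψ :
Literature.MathematicalPhysics.QuantumManyBody.BoseGas.PeriodicTrialState N
(Literature.MathematicalPhysics.QuantumManyBody.BoseGas.sideLength ρ N),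
Literature.MathematicalPhysics.QuantumManyBody.BoseGas.periodicEnergy v Ψ ≤
Literature.MathematicalPhysics.QuantumManyBody.BoseGas.periodicGroundStateEnergy v N
(Literature.MathematicalPhysics.QuantumManyBody.BoseGas.sideLength ρ N) + δ → let L : ℝ :=
Literature.MathematicalPhysics.QuantumManyBody.BoseGas.sideLength ρ N; (∑' k : Fin 3 → ℤ, if k ≠ 0 ∧
2 * Real.pi / L * ‖(WithLp.toLp 2 fun i => (k i : ℝ) : EuclideanSpace ℝ (Fin 3))‖ ≤ K₀ * Real.sqrt ρ
then Literature.MathematicalPhysics.QuantumManyBody.BoseGas.cellOccupation N L (fun x :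
EuclideanSpace ℝ (Fin 3) => ((Real.sqrt (L ^ 3))⁻¹ : ℂ) * Complex.exp (Complex.I * ↑(2 * Real.pi / L
* ∑ i, (k i : ℝ) * x i))) Ψ.ψ else 0) ≤ ENNReal.ofReal (N / 8)) ∧ (∀ v : ℝ → ENNReal,
Literature.MathematicalPhysics.QuantumManyBody.BoseGas.IsRepulsiveFiniteRange v → ∀ K₀ : ℝ, 0 < K₀ →
∃ ρ₀ : ℝ, 0 < ρ₀ ∧ ∀ ρ : ℝ, 0 < ρ → ρ < ρ₀ → ∀ᶠ N : ℕ in Filter.atTop, ∃ δ : ENNReal, 0 < δ ∧ ∀ Ψ :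
Literature.MathematicalPhysics.QuantumManyBody.BoseGas.PeriodicTrialState N
(Literature.MathematicalPhysics.QuantumManyBody.BoseGas.sideLength ρ N),
Literature.MathematicalPhysics.QuantumManyBody.BoseGas.periodicEnergy v Ψ ≤
Literature.MathematicalPhysics.QuantumManyBody.BoseGas.periodicGroundStateEnergy v N
(Literature.MathematicalPhysics.QuantumManyBody.BoseGas.sideLength ρ N) + δ → let L : ℝ :=
Literature.MathematicalPhysics.QuantumManyBody.BoseGas.sideLength ρ N; (∑' k : Fin 3 → ℤ, if K₀ *
Real.sqrt ρ < 2 * Real.pi / L * ‖(WithLp.toLp 2 fun i => (k i : ℝ) : EuclideanSpace ℝ (Fin 3))‖ then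
Literature.MathematicalPhysics.QuantumManyBody.BoseGas.cellOccupation N L (fun x : EuclideanSpace ℝ
(Fin 3) => ((Real.sqrt (L ^ 3))⁻¹ : ℂ) * Complex.exp (Complex.I * ↑(2 * Real.pi / L * ∑ i, (k i : ℝ)
* x i))) Ψ.ψ else 0) ≤ ENNReal.ofReal (N / 8))`

## Assembly
Pure logic (checked sorry-free in the planner's Sketch.lean: `fun h2 h3 h9 h5 v hv => h5 v hv ((h9
h2 h3) v hv)`): SplitToPeriodicBEC turns the two
halves into PeriodicBEC (its conclusion is the verbatim body of stmt-0826), BoundaryTransferWeak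
(verbatim stmt-0827) turns PeriodicBEC(v) into
HasGroundStateBEC v ρ for ρ < ρ₀(v), which is the conjunct. ForceStructureFactorBound is not a
hypothesis of the Assembly: it is the engine of the
IR half and is consumed formally by SmearedDipoleCost (ForceStructureFactorBound → SmearedDipoleCost
→ SmearedLinearResponse → TransportToIR →
IRDepletionBound also composes by pure logic in Sketch.lean).

Rationale: WHY THIS LINE. The depletion of a torus state is exactly a two-point slice variance, n₊ =
(N/2L³)∭|Ψ(x′,Y) − Ψ(x,Y)|² dx dx′ dY (DepletionVarianceIdentity; the honest
form of the card's Palm–Hellinger affinity, no positivity needed), and in momentum space n₊ =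
Σ_(p≠0) n_p splits at |p| = K₀√ρ ≈ 1/(Mξ), ξ = (8πρa)^(−1/2)
the healing length. Above the split the modes are those of boxes of side ~ Mξ = GP scale, where
complete condensation of near-minimisers IS the
proved cone (LiebSeiringerSolovejYngvason2005 Thm 5.1, Fournais2020 Thm 1.2 — both kernel-checked in
Literature) and only the local-to-global
bookkeeping for the thermodynamic-limit state is new (UVDepletionBound); the barrier
KineticGapLengthScales is respected there because the boxes
never exceed the GP scale. Below the split no gap exists and the card's mechanism takes over:
transport the Gaussian-smeared tagged boson from x to
x′ by the first-order displacement operator G = −Σ_j(φ(y_j)·∇_j + ½ div φ(y_j)) of an explicit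
periodic dipole field φ carrying one particle's worth
of bath mass (Mermin–Wagner/Richthammer2007 transport-of-configurations device, here at T = 0 on
|Ψ|², and in the quantum-impurity reading a
first-quantised Gross/Lee–Low–Pines coherent displacement, cf. MysliwySeiringer2020); its cost is a
quadratic form of φ̂ against the LONGITUDINAL
FORCE STRUCTURE FACTOR, which f-sum × Puff's third-moment sum rule (Stringari1995 pp. 72–76,
Puff1965, PitaevskiiStringari1991) bound by
C(|p|√ρ + p²(1+S(p))) uniformly down to |p| = 2π/L (ForceStructureFactorBound) — Gaussian domination
of the soft direction without reflection
positivity. In d = 3 the resulting far-field integral ∫(1−cos p·Δ)F_L(p)p^(d−3)dp is Δ-bounded, in d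
= 1 it is log Δ
(PitaevskiiStringariOneDimension), so the line predicts the right phase diagram. Imported areas: sum
rules / moment inequalities (many-body
physics), optimal-transport / Stein-type displacement bounds (probability), GP-scale variational
localisation (the LHY programme). What it does that
the four existing routes do not: BECInfraredBound asks for a POINTWISE infrared bound on Dirichlet
plane waves (refuter-flagged wall artefacts),
BECPinning/BECRenormGroup go through energies; here the target is the SUMMED infrared window on the
torus, the UV half is discharged by proved
facts, and the IR half comes with a typed mechanism (items
SmearedDipoleCost/SmearedLinearResponse/TransportToIR) and a typed, checkable engine.

RANKED CRUXES. #2 IRDepletionBound (crux) — far-field half. For every repulsive finite-range v there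
are K₀ > 0 and ρ₀ > 0 such that for 0 < ρ < ρ₀, all large N, some δ > 0 and every periodic
δ-near-minimiser Ψ on the torus of side L = (N/ρ)^(1/3), Σ over k ∈ ℤ³, k ≠ 0, (2π/L)|k| ≤ K₀√ρ of
the occupations ⟨φ_k, γ_Ψ φ_k⟩ (φ_k = L^(−3/2) e^(2πik·x/L) on the cell) is ≤ N/8. Bogoliubov
predicts ≈ 0.05·N K₀²√(aρ)·√(8πa)-small; the whole thermodynamic-limit difficulty (infrared
divergence scenario) is confined here. Card items T1–T3 are its foreseen children (filed as supports
SmearedDipoleCost, SmearedLinearResponse, TransportToIR). [difficulty: open-problem] (why it might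
fail: an anomalously soft branch could pile O(N) particles into 0<|p|≤K₀√ρ at L→∞ for every K₀ (the
d=1 log-divergence transplanted by some 3-D mechanism); nothing rigorous excludes n_p ≫ √ρL/|k| on
the torus today.) [Stringari1995, PitaevskiiStringari1991, LiebSeiringerSolovejYngvason2005,
KennedyLiebShastry1988, Literature.Barriers.AtomisticToContinuum.PitaevskiiStringariOneDimension,
Summits/AtomisticToContinuum/BoseEinsteinCondensation/Ideas/phonon-transport-fsum.md]
#3 UVDepletionBound (crux) — healing-scale half. For every repulsive finite-range v and every K₀ > 0
there is ρ₀ > 0 such that for 0 < ρ < ρ₀, all large N, some δ > 0 and every periodic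
δ-near-minimiser Ψ (L = (N/ρ)^(1/3)), Σ over k with (2π/L)|k| > K₀√ρ of ⟨φ_k, γ_Ψ φ_k⟩ is ≤ N/8.
Intended proof from PROVED cone facts only: Neumann-bracket the torus into boxes of side ℓ = Gξ with
G = G(K₀, a) (GP scale, g = ρaℓ² = G²/8π fixed); global energy ≤ 4πaρN(1 + o(1))
(LSSY2005_upperBound_periodic_holds) against Σ_boxes LSSY2005_lowerBound_neumann_holds ⇒ by Markov
all but an ε-fraction of particles sit in boxes with excess ≤ λ aρ N_B Y^(1/17); in those, LSSY Thm
5.1 / Lemma 4.1 + 5.2 (lemma41_holds, lemma52_periodic_holds; Fournais2020_condensation_holds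
beyond) give local depletion ≤ C(G,λ)Y^(1/17) N_B; finally Σ_(|p|>K₀√ρ) n_p ≤ C Σ_B (local depletion
in a finite-overlap cover of boxes of side 2ℓ) via 1 − |b̂_ℓ(p)|² ≥ c on |p| > K₀√ρ and Jensen.
[difficulty: L] (why it might fail: local energy slack is controlled only on average (Markov): bad
boxes may hold a non-vanishing particle fraction unless the convexity bookkeeping of n_B²/|B|
closes; Neumann local states are not periodic trial states (Thm 5.1/Fournais are vendored
periodic).) [LiebSeiringerSolovejYngvason2005, Fournais2020, Junge2026, BoccatoSeiringer2023,
FournaisEtAl2024,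
Literature.MathematicalPhysics.QuantumManyBody.BoseGas.Fournais2020_condensation_holds,
Literature.Barriers.AtomisticToContinuum.KineticGapLengthScales]
#4 ForceStructureFactorBound (crux) — the engine (card T1). For every repulsive finite-range v there
are ρ₀, C > 0 such that for 0 < ρ < ρ₀, all large N, some δ > 0, every periodic δ-near-minimiser Ψ
and every k ∈ ℤ³∖0 (kv = k as a vector, p = 2πk/L, q = |p|): ∫_cell^N |Σ_j e^(ip·x_j) (kv·∇_j)Ψ|² ≤
C|kv|²·[N(q√ρ + q²) + q² ∫|Σ_j e^(ip·x_j)|²|Ψ|²]. Proof for eigenstates with v ∈ C²: 2Σ_j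
e^(ipx_j)p·∇_jΨ₀ = i([H,ρ_p] − p²ρ_p)Ψ₀, ‖[H,ρ_p]Ψ₀‖² = N m₂(p) ≤ N√(m₁m₃), m₁(p)+m₁(−p) = 2Np²
(f-sum, exact), m₃ ≤ Np⁴(p² + C₁⟨T⟩/N + C₂ρ∫g r²|v″|) (Puff), ⟨T⟩/N ≤ Cρa
(LSSY2005_upperBound_periodic_holds); near-minimisers by compactness at fixed N. With F_L(p) :=
N⁻¹‖Σ_j e^(ip·x_j) p̂·∇_jΨ₀‖², Bogoliubov/RPA give F_L ≈ p√(πρa) (they saturate the Cramér–Rao form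
p²(1−S)² ≤ 4 S·F_L of the bound), while the unscreened Jastrow state Π f₀ has F_L → 2πρa as p → 0:
the engine EXCLUDES it at p ≪ 1/ξ. [difficulty: M] (why it might fail: hard cores / non-C² v: m₃ =
+∞ (S(k,ω) ~ ω^(−7/2) tail), so the f-sum×m₃ proof is void and a direct m₂ bound is needed; the C²
proof also needs a contact-scale bound ρ∫g r²|v″| ≤ C·a uniformly in N (pair density bounded near
the range), not in print.) [Stringari1995, Puff1965, PitaevskiiStringari1991, Griffin1993,
LiebSeiringerSolovejYngvason2005]
#5 BoundaryTransferWeak (crux) — shared verbatim with route BECPeriodicReduction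
(stmt-AtomisticToContinuum-0827): for each repulsive finite-range v, PeriodicBEC(v) implies ∃ρ₀>0
∀ρ∈(0,ρ₀) HasGroundStateBEC v ρ (Dirichlet ground state, mode-free λ_max via condensateNumber).
Expected route: Neumann bracketing of interior sub-boxes + a mode-free criterion; only the ENERGY
analogue is in print. [difficulty: L] (why it might fail: PeriodicBEC(v) is ground-state-only (δ
after N); the Dirichlet ground state restricted to interior boxes is neither periodic nor of sharp
particle number, so the hypothesis may never fire; BEC is BC-sensitive (Robinson 1976).)
[LiebSeiringerSolovejYngvason2005, BoccatoSeiringer2023, Junge2026, Basti2022,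
doi:10.1007/bf01608554]
#9 SplitToPeriodicBEC (support) — IRDepletionBound → UVDepletionBound → PeriodicBEC (body verbatim =
stmt-AtomisticToContinuum-0826, so BoundaryTransferWeak's hypothesis matches syntactically). Proof:
the plane waves (φ_k)_(k∈ℤ³) are an ONB of L²(cell), so Σ'_k cellOccupation φ_k = N for every
periodic trial state (Parseval in ENNReal, Fubini over Y); with K₀ from IR fed into UV, n₀ = N − IR
− UV ≥ 3N/4 ≥ N/2, δ = min(δ_IR, δ_UV), c = 1/2. Lean-heavy part: 3-D Fourier series on the cell
(Mathlib has AddCircle/UnitAddTorus in 1-D; product Parseval to be assembled). [difficulty: M]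
[LiebSeiringerSolovejYngvason2005, Fournais2020]
#9 SmearedDipoleCost (support) — Leg 1 of the transport plan, conditional on the engine (card T1 ⇒
Leg 1). Given ForceStructureFactorBound's body for v: there are K, C, ρ₀ > 0 such that for 0 < ρ <
ρ₀, all large n (N = n+1), some δ > 0, every periodic δ-near-minimiser Ψ and EVERY radius R with
K/√ρ ≤ R ≤ L/4: ∫_x∫_x′∫_Y |∫η_R(x−z)·Σ_j[φ_(x,x′)(y_j)·∇_(j+1)Ψ(z,Y) + ½ divφ_(x,x′)(y_j) Ψ(z,Y)]
dz|² ≤ C√ρ·L³, where η_R is the unit-mass Gaussian of width R, φ_(x,x′)(y) = (ρL³)⁻¹Σ_(k≠0)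
e^(−R²k²/4)(k/|k|²)[sin k·(y−x′) − sin k·(y−x)] is the periodic curl-free dipole field with div φ =
ρ⁻¹[η_R^per(·−x′) − η_R^per(·−x)] (digs the hole at x′, fills it at x). Heuristic size at R = Mξ:
far field c/(ρR²) ≈ 32π^(3/2)√(ρa³)/M² (paid by T1: ρ∫|φ̂|²F_L), div-term (count variance) ≈
(8π)^(3/2)√(ρa³)/M³, near field a/R — all O(√(ρa³)) = O_v(√ρ). Foreseen children: T1, off-diagonal
tameness of the density–force–force three-point function (card T2), S(k) ≤ C on k ≲ (log N)/R.
[difficulty: L] [Richthammer2007, Richthammer2016, FrohlichPfister1981, Stringari1995,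
MysliwySeiringer2020,
Summits/AtomisticToContinuum/BoseEinsteinCondensation/Ideas/phonon-transport-fsum.md]
#9 SmearedLinearResponse (support) — Leg 2 (card T3, 'linear response of the hole'), smeared: for
every v, every K > 0 and every ε > 0 there is ρ₀ > 0 such that for 0 < ρ < ρ₀, all large n, some δ >
0 and every periodic δ-near-minimiser Ψ there is a radius R with K ≤ R√ρ ≤ 2K such that ∫_x∫_x′∫_Y
|Ψ̄_R(x′,Y) − Ψ̄_R(x,Y) + (G-term of SmearedDipoleCost)|² ≤ εL³, Ψ̄_R(x,Y) = ∫η_R(x−z)Ψ(z,Y)dz: the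
smeared slice at x′ equals the first-order dipole transport of the smeared slice at x up to
o(1)·L^(3/2) in L². Honest status: given Leg 1 this is EQUIVALENT (triangle inequality both ways) to
complete condensation of the window |p| ≲ √ρ/K as ρ → 0; its content is that the RPA identity
Σ_jφ(y_j)·δF_j ≈ ½Σ_j[u(y_j−x) − u(y_j−x′)] (the phonon dressing of the tagged boson IS a coherent
displacement) holds in L²(|Ψ|²) at k < 1/R, so only beyond-RPA three-point terms and the O(ρa³) core
remain. [difficulty: XL] [ReattoChester1967, GavoretNozieres1964, MysliwySeiringer2020,
Stringari1995, Summits/AtomisticToContinuum/BoseEinsteinCondensation/Ideas/phonon-transport-fsum.md]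
#9 TransportToIR (support) — glue of the foreseen split of IRDepletionBound: (Leg-1 body for every
v) → SmearedLinearResponse → IRDepletionBound. Proof: take K, C from Leg 1, apply Leg 2 with that K
and ε = 1/64, shrink ρ₀ so that C√ρ ≤ 1/64 and 2K/√ρ ≤ L/4 eventually; Minkowski in
L²(cell²×cell^n): ∭|Ψ̄_R(x′)−Ψ̄_R(x)|² ≤ (1/8+1/8)²L³; smeared variance identity Σ_(k≠0) e^(−R²p²/2)
n_p = (N/2L³)∭|Ψ̄_R(x′,·)−Ψ̄_R(x,·)|² (Parseval + convolution theorem on the torus, Ψ periodic so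
the ℝ³-Gaussian smearing is the periodised one); Gaussian monotonicity with K₀ := 1/(2K):
1_(0<|p|≤K₀√ρ) ≤ e^(1/2) e^(−R²p²/2); hence IR ≤ e^(1/2)(N/2)(1/16) ≤ N/8; index shift n+1 ↔ N under
∀ᶠ. [difficulty: M] [LiebSeiringerSolovejYngvason2005, Richthammer2007]
#9 DepletionVarianceIdentity (support) — for every n, L and every periodic trial state Ψ of n+1
particles on the torus of side L: condensateOccupation (n+1) L Ψ + ((n+1)/(2L³))·∫_x∫_x′∫_Y |Ψ(x′,Y)
− Ψ(x,Y)|² = n+1 (x, x′ over the cell, Y over cell^n). Proof: ⟨f,(1−P₀)f⟩ = ‖f‖² − L⁻³|∫f|² =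
(2L³)⁻¹∬|f(x)−f(x′)|² for f = Ψ(·,Y) ∈ L²(cell), Fubini over Y, normalisation via the
measure-preserving split Config(n+1) ≅ Space × Config n (Matrix.vecCons). The identity behind the
whole transport reading (depletion = two-point slice variance = N·(1 − mean Bhattacharyya affinity
of the Palm measures) for Ψ ≥ 0); provable now. [difficulty: provable-now]
[LiebSeiringerSolovejYngvason2005, PenroseOnsager1956]

TWO-LAYER PLAN. IRDepletionBound ⇐ SmearedDipoleCost′ (unconditional Leg 1) → SmearedLinearResponse
→ IRDepletionBound, glue = TransportToIR (all three typed and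
filed as supports now so grounders can stamp them; the formal `--split` is issued when
ForceStructureFactorBound or a leg closes).
SmearedDipoleCost ⇐ ForceStructureFactorBound → OffDiagonalTameness (card T2: the
tagged-density–force–force three-point function is O(1)) →
NearFieldAndCountVariance (S(k) ≤ C for k ≲ (log N)/R; Var N_R ≤ CρR³) → Leg 1. UVDepletionBound ⇐
LocalEnergyMarkov (all but εN particles in
GP-boxes with excess ≤ λaρN_B Y^(1/17), from upperBound_periodic + lowerBound_neumann +
superadditivity) → LocalToGlobalOccupations (high-pass ≤
C·Σ_boxes local depletion, Jensen + Lemma 4.1) → UV. ForceStructureFactorBound ⇐ (eigenstate sum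
rules m₁, m₃ for C² v) → (contact-scale pair
bound) → (near-minimiser compactness). Hard cores: a separate m₂ engine (contact-value form), not
filed.

KILL CRITERIA. ¬IRDepletionBound for some admissible v at arbitrarily small ρ (an O(N) infrared
pile-up on the torus) closes the route `refuted:IRDepletionBound`
and, with UV, refutes PeriodicBEC itself — hand the witness to BECPeriodicReduction.
¬ForceStructureFactorBound exhibited for a C² potential kills the
ENGINE (pivot: IR by another far-field device, e.g. BECInfraredBound's pointwise bound restricted to
the torus); exhibited only for hard cores it
forces the hard-core m₂ engine (restate with the C²/bounded-v hypothesis, file the contact-value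
version). ¬UVDepletionBound would contradict the
proved GP-scale condensation plus bookkeeping — it would mean the local-to-global step fails, pivot
to LHY-precision local control
(FournaisSolovej2020/2022 + Basti2022-type upper bounds, Junge2026 Neumann localisation).
¬SmearedLinearResponse with IR still open: the dipole
corrector is the wrong far-field object — pivot the IR children to the mode-wise by-product of the
card (n_q ≲ C/(qξ) + non-condensate current
moments). PeriodicBEC proved elsewhere moots items 2, 3 and the supports; ¬BoundaryTransferWeak
kills this route together with BECPeriodicReduction
(not the conjunct).

NOT DECOMPOSED YET. The children listed in the two-layer plan (T2 off-diagonal tameness, count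
variance / S(k) ≤ C, near field; the Markov/local-to-global lemmas of
UV; the eigenstate-to-near-minimiser compactness and the contact-scale pair bound of the engine) —
layer 2, after a crux closes. The hard-core
engine. Dirichlet transfer beyond the shared crux (route BECPeriodicReduction owns it). Positive
temperature. The d = 1, 2 analogues (sanity
checks only: the same legs give log L in d = 1 and stay bounded in d = 2).

CHEAPEST FALSIFIER. Two-page Bogoliubov evaluation (refuters first): with S(p) = p/√(p²+16πρa) and
F_L from the single-mode form, (i) check ForceStructureFactorBound's
shape F_L(p) ≈ p√(πρa) ≤ C(p√ρ + p²) with C ≈ √(πa), and that the unscreened Jastrow state Π f₀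
violates it (F_L → 2πρa at p → 0) — if
Bogoliubov itself violated it the engine is misstated; (ii) evaluate Leg 1 at R = Mξ:
32π^(3/2)√(ρa³)/M² + (8π)^(3/2)√(ρa³)/M³ must be
L-independent in d = 3 and ∝ log L in d = 1; (iii) v ≡ 0: every item holds (Ψ₀ constant: engine LHS
= 0, Leg-1 cost = O(√ρ/K³)·L³ from the count-variance term alone,
IR = UV = 0) — done by hand while typing, passes. Lookup that would downgrade the engine to `known`:
a printed bound on the T = 0 longitudinal
CURRENT structure factor by √(m₁m₃)/p² used as an infrared bound (searched Stringari1995 pp. 72–76,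
Puff1965, Griffin1993 ch. 8: moment
inequalities present, this use absent).

NUMBERS. ξ = (8πρa)^(−1/2); Bogoliubov depletion 1 − n₀/N = (8/3√π)√(ρa³) ≈ 1.505√(ρa³); LHY 4πρa(1
+ 128/(15√π)√(ρa³)); Bogoliubov n_p ≈ 1/(2√2 pξ) for
p ≪ 1/ξ, (ρ·4πa)²/p⁴ beyond; IR window share Σ_(|p|≤K₀√ρ) n_p/N ≈ K₀²√(8πa)·√ρ/(8√2π²) — tiny; Leg-1
cost at R = Mξ ≈ (178/M² + 126/M³)√(ρa³);
f-sum m₁ = Np² (ħ = 2m = 1); engine constant C ≈ √(πa) (first term); GP-box side for UV: ℓ = Gξ with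
G ≳ π√(8πa)/K₀; LSSY Thm 2.4 error Y^(1/17), Y = 4πρa³/3,
box condition ℓ/a > C′Y^(−6/17) holds at ℓ = Gξ ∝ a(ρa³)^(−1/2). Items at open: 10 (4 cruxes, 5
supports, 1 assembly).

DEFINITION REQUESTS. None. Everything is typed over
Literature.MathematicalPhysics.QuantumManyBody.BoseGas.(PeriodicTrialState, periodicEnergy,
periodicGroundStateEnergy, cellOccupation, condensateOccupation, cell, cellN, sideLength,
IsRepulsiveFiniteRange, HasGroundStateBEC,
BoseEinsteinCondensation) + Mathlib (fderiv, lintegral, Bochner integral, tsum, Matrix.vecCons,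
Pi.single, WithLp.toLp, Complex.exp); the dipole
field, its divergence and the Gaussian are written inline as absolutely convergent lattice sums.
Bib: Puff1965 present (lit cite
doi:10.1103/PhysRev.137.A406).

Novelty: Searches (2026-08-15): `lit frontier AtomisticToContinuum --since 2020` (30 rows; BEC descendants
arXiv:2603.20776 Junge2026, arXiv:2510.20493
ChongLiangNam2026, arXiv:2602.16566 — all gap/localisation, none infrared); `lit bridges
AtomisticToContinuum --cross any` (30 rows, no Bose-gas
bridge); `lit search --hybrid` ×3 ("third moment sum rule longitudinal current fluctuations Bose gas
ground state f-sum rule" → Stringari1995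
pp. 72–78, Griffin1993 p. 170, Lipparini2008, DiCastroRaimondi2015; "condensate depletion split low
momenta high momenta localization Neumann boxes"
→ LSSY2005 pp. 100–104 only; vsearch of the slice-variance identity → LSSY2005 p. 104, Griffin1995
p. 103: textbook one-body identities, not this
use); `lit search --source crossref` ×4 (doi:10.1007/s00220-007-0274-7 Richthammer2007,
doi:10.1016/j.spa.2008.04.001; polaron/sum-rule rows
off-target); OpenAlex/S2/arXiv HTTP 429 (daily budget), local FTS tier reset ×6, `lit galaxy search
--star all` ×3 queued > 90 s (saturated) —
recorded in NOTES.md; card audit-13 searches (zbMATH/crossref: 'Stein operator Hellinger transport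
Palm' 0 hits; electron-liquid m₃ papers only)
inherited. Ledger: 4 route files of the sub read in full; `ledger negatives` empty.
Nearest prior art found: Stringari1995 (book:griffin1995-bose-einstein-condensation pp. 72–76: m₃/m₁
and uncertainty inequalities used for
HMW-type NO-GO and ω₀ bounds, never for a transport cost or an infrared OCCUPATION bound in d = 3),
Puff1965 (the m₃ sum ru  [refs: 10.1007/s00220-007-0274-7, 10.1016/j.spa.2008.04.001, 2603.20776, 2510.20493, 2602.16566, doi:10.1007/s00220-007-0274-7, doi:10.1016/j.spa.2008.04.001, book:griffin1995-bose-einstein-condensation, Junge2026, ChongLiangNam2026, Stringari1995, Griffin1993, DiCastroRaimondi2015, LSSY2005, Richthammer2007, Puff1965, KennedyLiebShastry1988, FrohlichPfister1981, MysliwySeiringer2020, Fournais2020]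

Barriers (technique_class: sum-rules transport-plan regime-split localization): - technique_class: sum-rules transport-plan regime-split localization
- Literature.Barriers.AtomisticToContinuum.KineticGapLengthScales: RESPECTED, not fought:
gap/localisation technology is used only for UVDepletionBound, on boxes of side Gξ (GP scale, inside
the proved reach of LSSY Thm 5.1 / Fournais2020 Thm 1.2); the thermodynamic-limit step is
IRDepletionBound, whose engine inverts no gap (only positive moments m₁, m₂, m₃ — that is why p =
2π/L is harmless).
- Literature.Barriers.AtomisticToContinuum.KineticGapLengthScalesNarrow: the items are energy-window
STATEMENTS with δ chosen after N (below the boost gap 4π²N/L², so the Galilei-boost witnesses are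
outside the window), but the IR half is NOT an energy-window ARGUMENT: its engine uses the
eigenvalue equation (f-sum and Puff double commutators for eigenstates, i.e. minimality beyond the
value of E₀ — listed by the entry as outside the class) and transfers to near-minimisers by
compactness at fixed N; the UV half IS in the class but only at box sides ℓ = Gξ with ρaℓ²·Y^(1/17)
= G²Y^(1/17)/8π ≲ 1, i.e. inside the entry's certified reach L/a ≲ (ρa³ε)^(−1/2).
- Literature.Barriers.AtomisticToContinuum.PitaevskiiStringariOneDimension: respected and USED as
the sanity check: the same sum rules give F_L ≲ p/ξ, and the Leg-1 far-field integral ∫(1−cos pΔ)F_L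
p^(d−3)dp diverges like log Δ exactly in d = 1, bounded for d ≥ 2 — the line proves nothing false in
one dimension.
- Literature.Barriers.AtomisticToContinuum.PitaevskiiS

History (route lifecycle, newest last):
- 2026-08-15T13:39:31Z · CLOSED retired — not-a-thesis: assembly does not conclude the sub-problem Statement (operator:999:1257524)

sub-problem: BoseEinsteinCondensation · status: closed(retired) · opened planner-plancard-AtomisticToContinuum-BoseEin-04a5b708-0 2026-08-15T11:47:47Z · rev 0 · ledger route-AtomisticToContinuum-BECPhononTransport
GENERATED by the gate from the ledger (D-0016/17). Provers cite these decls: `theorem foo : Summit.AtomisticToContinuum.BoseEinsteinCondensation.Theses.BECPhononTransport.<Decl> := …` in Summits/AtomisticToContinuum/BoseEinsteinCondensation/Theorems/<Name>.lean.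
-/

namespace Summit.AtomisticToContinuum.BoseEinsteinCondensation.Theses.BECPhononTransport

open scoped BigOperators Topology Manifold Classical MeasureTheory ProbabilityTheory Matrix InnerProductSpace ComplexConjugate ContinuousMap
open Filter Set Function TopologicalSpace MeasureTheory

attribute [summit_statement] _root_.BoseEinsteinCondensation

/-- item stmt-AtomisticToContinuum-6505 · crux · rank 2 · closed · moot by None · by planner
why it might fail: an anomalously soft branch could pile O(N) particles into 0<|p|≤K₀√ρ at L→∞ for every K₀ (the d=1 log-divergence transplanted by some 3-D mechanism); nothing rigorous excludes n_p ≫ √ρL/|k| on the torus today.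
sources: Stringari1995, PitaevskiiStringari1991, LiebSeiringerSolovejYngvason2005, KennedyLiebShastry1988, Literature.Barriers.AtomisticToContinuum.PitaevskiiStringariOneDimension, Summits/AtomisticToContinuum/BoseEinsteinCondensation/Ideas/phonon-transport-fsum.md
[crux] far-field half. For every repulsive finite-range v there are K₀ > 0 and ρ₀ > 0 such that for
0 < ρ < ρ₀, all large N, some δ > 0 and every periodic δ-near-minimiser Ψ on the torus of side L =
(N/ρ)^(1/3), Σ over k ∈ ℤ³, k ≠ 0, (2π/L)|k| ≤ K₀√ρ of the occupations ⟨φ_k, γ_Ψ φ_k⟩ (φ_k =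
L^(−3/2) e^(2πik·x/L) on the cell) is ≤ N/8. Bogoliubov predicts ≈ 0.05·N K₀²√(aρ)·√(8πa)-small; the
whole thermodynamic-limit difficulty (infrared divergence scenario) is confined here. Card items
T1–T3 are its foreseen children (filed as supports SmearedDipoleCost, SmearedLinearResponse,
TransportToIR). [difficulty: open-problem] -/
@[route_item "route-AtomisticToContinuum-BECPhononTransport"]
def IRDepletionBound : Prop :=
  ∀ v : ℝ → ENNReal, Literature.MathematicalPhysics.QuantumManyBody.BoseGas.IsRepulsiveFiniteRange v → ∃ K₀ : ℝ, 0 < K₀ ∧ ∃ ρ₀ : ℝ, 0 < ρ₀ ∧ ∀ ρ : ℝ, 0 < ρ → ρ < ρ₀ → ∀ᶠ N : ℕ in Filter.atTop, ∃ δ : ENNReal, 0 < δ ∧ ∀ Ψ : Literature.MathematicalPhysics.QuantumManyBody.BoseGas.PeriodicTrialState N (Literature.MathematicalPhysics.QuantumManyBody.BoseGas.sideLength ρ N), Literature.MathematicalPhysics.QuantumManyBody.BoseGas.periodicEnergy v Ψ ≤ Literature.MathematicalPhysics.QuantumManyBody.BoseGas.periodicGroundStateEnergy v N (Literature.MathematicalPhysics.QuantumManyBody.BoseGas.sideLength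 ρ N) + δ → let L : ℝ := Literature.MathematicalPhysics.QuantumManyBody.BoseGas.sideLength ρ N; (∑' k : Fin 3 → ℤ, if k ≠ 0 ∧ 2 * Real.pi / L * ‖(WithLp.toLp 2 fun i => (k i : ℝ) : EuclideanSpace ℝ (Fin 3))‖ ≤ K₀ * Real.sqrt ρ then Literature.MathematicalPhysics.QuantumManyBody.BoseGas.cellOccupation N L (fun x : EuclideanSpace ℝ (Fin 3) => ((Real.sqrt (L ^ 3))⁻¹ : ℂ) * Complex.exp (Complex.I * ↑(2 * Real.pi / L * ∑ i, (k i : ℝ) * x i))) Ψ.ψ else 0) ≤ ENNReal.ofReal (N / 8)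

/-- item stmt-AtomisticToContinuum-6506 · crux · rank 3 · closed · moot by None · by planner
why it might fail: local energy slack is controlled only on average (Markov): bad boxes may hold a non-vanishing particle fraction unless the convexity bookkeeping of n_B²/|B| closes; Neumann local states are not periodic trial states (Thm 5.1/Fournais are vendored periodic).
sources: LiebSeiringerSolovejYngvason2005, Fournais2020, Junge2026, BoccatoSeiringer2023, FournaisEtAl2024, Literature.MathematicalPhysics.QuantumManyBody.BoseGas.Fournais2020_condensation_holds
[crux] healing-scale half. For every repulsive finite-range v and every K₀ > 0 there is ρ₀ > 0 such
that for 0 < ρ < ρ₀, all large N, some δ > 0 and every periodic δ-near-minimiser Ψ (L =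
(N/ρ)^(1/3)), Σ over k with (2π/L)|k| > K₀√ρ of ⟨φ_k, γ_Ψ φ_k⟩ is ≤ N/8. Intended proof from PROVED
cone facts only: Neumann-bracket the torus into boxes of side ℓ = Gξ with G = G(K₀, a) (GP scale, g
= ρaℓ² = G²/8π fixed); global energy ≤ 4πaρN(1 + o(1)) (LSSY2005_upperBound_periodic_holds) against
Σ_boxes LSSY2005_lowerBound_neumann_holds ⇒ by Markov all but an ε-fraction of particles sit in
boxes with excess ≤ λ aρ N_B Y^(1/17); in those, LSSY Thm 5.1 / Lemma 4.1 + 5.2 (lemma41_holds,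
lemma52_periodic_holds; Fournais2020_condensation_holds beyond) give local depletion ≤
C(G,λ)Y^(1/17) N_B; finally Σ_(|p|>K₀√ρ) n_p ≤ C Σ_B (local depletion in a finite-overlap cover of
boxes of side 2ℓ) via 1 − |b̂_ℓ(p)|² ≥ c on |p| > K₀√ρ and Jensen. [difficulty: L] -/
@[route_item "route-AtomisticToContinuum-BECPhononTransport"]
def UVDepletionBound : Prop :=
  ∀ v : ℝ → ENNReal, Literature.MathematicalPhysics.QuantumManyBody.BoseGas.IsRepulsiveFiniteRange v → ∀ K₀ : ℝ, 0 < K₀ → ∃ ρ₀ : ℝ, 0 < ρ₀ ∧ ∀ ρ : ℝ, 0 < ρ → ρ < ρ₀ → ∀ᶠ N : ℕ in Filter.atTop, ∃ δ : ENNReal, 0 < δ ∧ ∀ Ψ : Literature.MathematicalPhysics.QuantumManyBody.BoseGas.PeriodicTrialState N (Literature.MathematicalPhysics.QuantumManyBody.BoseGas.sideLength ρ N), Literature.MathematicalPhysics.QuantumManyBody.BoseGas.periodicEnergy v Ψ ≤ Literature.MathematicalPhysics.QuantumManyBody.BoseGas.periodicGroundStateEnergy v N (Literature.MathematicalPhysics.QuantumManyBody.BoseGas.sideLength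 ρ N) + δ → let L : ℝ := Literature.MathematicalPhysics.QuantumManyBody.BoseGas.sideLength ρ N; (∑' k : Fin 3 → ℤ, if K₀ * Real.sqrt ρ < 2 * Real.pi / L * ‖(WithLp.toLp 2 fun i => (k i : ℝ) : EuclideanSpace ℝ (Fin 3))‖ then Literature.MathematicalPhysics.QuantumManyBody.BoseGas.cellOccupation N L (fun x : EuclideanSpace ℝ (Fin 3) => ((Real.sqrt (L ^ 3))⁻¹ : ℂ) * Complex.exp (Complex.I * ↑(2 * Real.pi / L * ∑ i, (k i : ℝ) * x i))) Ψ.ψ else 0) ≤ ENNReal.ofReal (N / 8)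

/-- item stmt-AtomisticToContinuum-6507 · crux · rank 4 · closed · moot by None · by planner
why it might fail: hard cores / non-C² v: m₃ = +∞ (S(k,ω) ~ ω^(−7/2) tail), so the f-sum×m₃ proof is void and a direct m₂ bound is needed; the C² proof also needs a contact-scale bound ρ∫g r²|v″| ≤ C·a uniformly in N (pair density bounded near the range), not in print.
sources: Stringari1995, Puff1965, PitaevskiiStringari1991, Griffin1993, LiebSeiringerSolovejYngvason2005
[crux] the engine (card T1). For every repulsive finite-range v there are ρ₀, C > 0 such that for 0
< ρ < ρ₀, all large N, some δ > 0, every periodic δ-near-minimiser Ψ and every k ∈ ℤ³∖0 (kv = k as a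
vector, p = 2πk/L, q = |p|): ∫_cell^N |Σ_j e^(ip·x_j) (kv·∇_j)Ψ|² ≤ C|kv|²·[N(q√ρ + q²) + q² ∫|Σ_j
e^(ip·x_j)|²|Ψ|²]. Proof for eigenstates with v ∈ C²: 2Σ_j e^(ipx_j)p·∇_jΨ₀ = i([H,ρ_p] − p²ρ_p)Ψ₀,
‖[H,ρ_p]Ψ₀‖² = N m₂(p) ≤ N√(m₁m₃), m₁(p)+m₁(−p) = 2Np² (f-sum, exact), m₃ ≤ Np⁴(p² + C₁⟨T⟩/N + C₂ρ∫g
r²|v″|) (Puff), ⟨T⟩/N ≤ Cρa (LSSY2005_upperBound_periodic_holds); near-minimisers by compactness at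
fixed N. With F_L(p) := N⁻¹‖Σ_j e^(ip·x_j) p̂·∇_jΨ₀‖², Bogoliubov/RPA give F_L ≈ p√(πρa) (they
saturate the Cramér–Rao form p²(1−S)² ≤ 4 S·F_L of the bound), while the unscreened Jastrow state Π
f₀ has F_L → 2πρa as p → 0: the engine EXCLUDES it at p ≪ 1/ξ. [difficulty: M] -/
@[route_item "route-AtomisticToContinuum-BECPhononTransport"]
def ForceStructureFactorBound : Prop :=
  ∀ v : ℝ → ENNReal, Literature.MathematicalPhysics.QuantumManyBody.BoseGas.IsRepulsiveFiniteRange v → ∃ ρ₀ : ℝ, 0 < ρ₀ ∧ ∃ C : ℝ, 0 < C ∧ ∀ ρ : ℝ, 0 < ρ → ρ < ρ₀ → ∀ᶠ N : ℕ in Filter.atTop, ∃ δ : ENNReal, 0 < δ ∧ ∀ Ψ : Literature.MathematicalPhysics.QuantumManyBody.BoseGas.PeriodicTrialState N (Literature.MathematicalPhysics.QuantumManyBody.BoseGas.sideLength ρ N), Literature.MathematicalPhysics.QuantumManyBody.BoseGas.periodicEnergy v Ψ ≤ Literature.MathematicalPhysics.QuantumManyBody.BoseGas.periodicGroundStateEnergy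 v N (Literature.MathematicalPhysics.QuantumManyBody.BoseGas.sideLength ρ N) + δ → ∀ k : Fin 3 → ℤ, k ≠ 0 → let L : ℝ := Literature.MathematicalPhysics.QuantumManyBody.BoseGas.sideLength ρ N; let kv : EuclideanSpace ℝ (Fin 3) := WithLp.toLp 2 fun i => (k i : ℝ); let q : ℝ := 2 * Real.pi * ‖kv‖ / L; ∫⁻ X in Literature.MathematicalPhysics.QuantumManyBody.BoseGas.cellN N L, (‖∑ j : Fin N, Complex.exp (Complex.I * ↑(2 * Real.pi / L * ∑ i, (k i : ℝ) * X j i)) * fderiv ℝ Ψ.ψ X (Pi.single j kv)‖₊ : ENNReal) ^ 2 ≤ ENNReal.ofReal (C * ‖kv‖ ^ 2 * N * (q * Real.sqrt ρ + q ^ 2)) + ENNReal.ofReal (C * ‖kv‖ ^ 2 * q ^ 2) * ∫⁻ X in Literature.MathematicalPhysics.QuantumManyBody.BoseGas.cellN N L, (‖∑ j : Fin N, Complex.exp (Complex.I * ↑(2 * Real.pi / L * ∑ i, (k i : ℝ) * X j i))‖₊ : ENNReal) ^ 2 * (‖Ψ.ψ X‖₊ : ENNReal) ^ 2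

/-- item stmt-AtomisticToContinuum-6508 · support · rank 9 · closed · moot by None · by planner
sources: LiebSeiringerSolovejYngvason2005, Fournais2020
[support] IRDepletionBound → UVDepletionBound → PeriodicBEC (body verbatim =
stmt-AtomisticToContinuum-0826, so BoundaryTransferWeak's hypothesis matches syntactically). Proof:
the plane waves (φ_k)_(k∈ℤ³) are an ONB of L²(cell), so Σ'_k cellOccupation φ_k = N for every
periodic trial state (Parseval in ENNReal, Fubini over Y); with K₀ from IR fed into UV, n₀ = N − IR
− UV ≥ 3N/4 ≥ N/2, δ = min(δ_IR, δ_UV), c = 1/2. Lean-heavy part: 3-D Fourier series on the cell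
(Mathlib has AddCircle/UnitAddTorus in 1-D; product Parseval to be assembled). [difficulty: M] -/
@[route_item "route-AtomisticToContinuum-BECPhononTransport"]
def SplitToPeriodicBEC : Prop :=
  (∀ v : ℝ → ENNReal, Literature.MathematicalPhysics.QuantumManyBody.BoseGas.IsRepulsiveFiniteRange v → ∃ K₀ : ℝ, 0 < K₀ ∧ ∃ ρ₀ : ℝ, 0 < ρ₀ ∧ ∀ ρ : ℝ, 0 < ρ → ρ < ρ₀ → ∀ᶠ N : ℕ in Filter.atTop, ∃ δ : ENNReal, 0 < δ ∧ ∀ Ψ : Literature.MathematicalPhysics.QuantumManyBody.BoseGas.PeriodicTrialState N (Literature.MathematicalPhysics.QuantumManyBody.BoseGas.sideLength ρ N), Literature.MathematicalPhysics.QuantumManyBody.BoseGas.periodicEnergy v Ψ ≤ Literature.MathematicalPhysics.QuantumManyBody.BoseGas.periodicGroundStateEnergy v N (Literature.MathematicalPhysics.QuantumManyBody.BoseGas.sideLength ρ N) + δ → let L : ℝ := Literature.MathematicalPhysics.QuantumManyBody.BoseGas.sideLength ρ N; (∑' k : Fin 3 → ℤ, if k ≠ 0 ∧ 2 * Real.pi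 / L * ‖(WithLp.toLp 2 fun i => (k i : ℝ) : EuclideanSpace ℝ (Fin 3))‖ ≤ K₀ * Real.sqrt ρ then Literature.MathematicalPhysics.QuantumManyBody.BoseGas.cellOccupation N L (fun x : EuclideanSpace ℝ (Fin 3) => ((Real.sqrt (L ^ 3))⁻¹ : ℂ) * Complex.exp (Complex.I * ↑(2 * Real.pi / L * ∑ i, (k i : ℝ) * x i))) Ψ.ψ else 0) ≤ ENNReal.ofReal (N / 8)) → (∀ v : ℝ → ENNReal, Literature.MathematicalPhysics.QuantumManyBody.BoseGas.IsRepulsiveFiniteRange v → ∀ K₀ : ℝ, 0 < K₀ → ∃ ρ₀ : ℝ, 0 < ρ₀ ∧ ∀ ρ : ℝ, 0 < ρ → ρ < ρ₀ → ∀ᶠ N : ℕ in Filter.atTop, ∃ δ : ENNReal, 0 < δ ∧ ∀ Ψ : Literature.MathematicalPhysics.QuantumManyBody.BoseGas.PeriodicTrialState N (Literature.MathematicalPhysics.QuantumManyBody.BoseGas.sideLength ρ N), Literature.MathematicalPhysics.QuantumManyBody.BoseGas.periodicEnergy v Ψ ≤ Literature.MathematicalPhysics.QuantumManyBody.BoseGas.periodicGroundStateEnergy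 v N (Literature.MathematicalPhysics.QuantumManyBody.BoseGas.sideLength ρ N) + δ → let L : ℝ := Literature.MathematicalPhysics.QuantumManyBody.BoseGas.sideLength ρ N; (∑' k : Fin 3 → ℤ, if K₀ * Real.sqrt ρ < 2 * Real.pi / L * ‖(WithLp.toLp 2 fun i => (k i : ℝ) : EuclideanSpace ℝ (Fin 3))‖ then Literature.MathematicalPhysics.QuantumManyBody.BoseGas.cellOccupation N L (fun x : EuclideanSpace ℝ (Fin 3) => ((Real.sqrt (L ^ 3))⁻¹ : ℂ) * Complex.exp (Complex.I * ↑(2 * Real.pi / L * ∑ i, (k i : ℝ) * x i))) Ψ.ψ else 0) ≤ ENNReal.ofReal (N / 8)) → ∀ v : ℝ → ENNReal, Literature.MathematicalPhysics.QuantumManyBody.BoseGas.IsRepulsiveFiniteRange v → ∃ ρ₀ : ℝ, 0 < ρ₀ ∧ ∀ ρ : ℝ, 0 < ρ → ρ < ρ₀ → ∃ c : ℝ, 0 < c ∧ ∀ᶠ N : ℕ in Filter.atTop, ∃ δ : ENNReal, 0 < δ ∧ ∀ Ψ : Literature.MathematicalPhysics.QuantumManyBody.BoseGas.PeriodicTrialState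 N (Literature.MathematicalPhysics.QuantumManyBody.BoseGas.sideLength ρ N), Literature.MathematicalPhysics.QuantumManyBody.BoseGas.periodicEnergy v Ψ ≤ Literature.MathematicalPhysics.QuantumManyBody.BoseGas.periodicGroundStateEnergy v N (Literature.MathematicalPhysics.QuantumManyBody.BoseGas.sideLength ρ N) + δ → ENNReal.ofReal (c * N) ≤ Literature.MathematicalPhysics.QuantumManyBody.BoseGas.condensateOccupation N (Literature.MathematicalPhysics.QuantumManyBody.BoseGas.sideLength ρ N) Ψ.ψ

/-- item stmt-AtomisticToContinuum-6509 · support · rank 9 · closed · moot by None · by planner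
sources: Richthammer2007, Richthammer2016, FrohlichPfister1981, Stringari1995, MysliwySeiringer2020, Summits/AtomisticToContinuum/BoseEinsteinCondensation/Ideas/phonon-transport-fsum.md
[support] Leg 1 of the transport plan, conditional on the engine (card T1 ⇒ Leg 1). Given
ForceStructureFactorBound's body for v: there are K, C, ρ₀ > 0 such that for 0 < ρ < ρ₀, all large n
(N = n+1), some δ > 0, every periodic δ-near-minimiser Ψ and EVERY radius R with K/√ρ ≤ R ≤ L/4:
∫_x∫_x′∫_Y |∫η_R(x−z)·Σ_j[φ_(x,x′)(y_j)·∇_(j+1)Ψ(z,Y) + ½ divφ_(x,x′)(y_j) Ψ(z,Y)] dz|² ≤ C√ρ·L³,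
where η_R is the unit-mass Gaussian of width R, φ_(x,x′)(y) = (ρL³)⁻¹Σ_(k≠0) e^(−R²k²/4)(k/|k|²)[sin
k·(y−x′) − sin k·(y−x)] is the periodic curl-free dipole field with div φ = ρ⁻¹[η_R^per(·−x′) −
η_R^per(·−x)] (digs the hole at x′, fills it at x). Heuristic size at R = Mξ: far field c/(ρR²) ≈
32π^(3/2)√(ρa³)/M² (paid by T1: ρ∫|φ̂|²F_L), div-term (count variance) ≈ (8π)^(3/2)√(ρa³)/M³, near
field a/R — all O(√(ρa³)) = O_v(√ρ). Foreseen children: T1, off-diagonal tameness of the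
density–force–force three-point function (card T2), S(k) ≤ C on k ≲ (log N)/R. [difficulty: L] -/
@[route_item "route-AtomisticToContinuum-BECPhononTransport"]
def SmearedDipoleCost : Prop :=
  ∀ v : ℝ → ENNReal, Literature.MathematicalPhysics.QuantumManyBody.BoseGas.IsRepulsiveFiniteRange v → (∃ ρ₀ : ℝ, 0 < ρ₀ ∧ ∃ C : ℝ, 0 < C ∧ ∀ ρ : ℝ, 0 < ρ → ρ < ρ₀ → ∀ᶠ N : ℕ in Filter.atTop, ∃ δ : ENNReal, 0 < δ ∧ ∀ Ψ : Literature.MathematicalPhysics.QuantumManyBody.BoseGas.PeriodicTrialState N (Literature.MathematicalPhysics.QuantumManyBody.BoseGas.sideLength ρ N), Literature.MathematicalPhysics.QuantumManyBody.BoseGas.periodicEnergy v Ψ ≤ Literature.MathematicalPhysics.QuantumManyBody.BoseGas.periodicGroundStateEnergy v N (Literature.MathematicalPhysics.QuantumManyBody.BoseGas.sideLength ρ N) + δ → ∀ k : Fin 3 → ℤ, k ≠ 0 → let L : ℝ := Literature.MathematicalPhysics.QuantumManyBody.BoseGas.sideLength ρ N; let kv : EuclideanSpace ℝ (Fin 3)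 := WithLp.toLp 2 fun i => (k i : ℝ); let q : ℝ := 2 * Real.pi * ‖kv‖ / L; ∫⁻ X in Literature.MathematicalPhysics.QuantumManyBody.BoseGas.cellN N L, (‖∑ j : Fin N, Complex.exp (Complex.I * ↑(2 * Real.pi / L * ∑ i, (k i : ℝ) * X j i)) * fderiv ℝ Ψ.ψ X (Pi.single j kv)‖₊ : ENNReal) ^ 2 ≤ ENNReal.ofReal (C * ‖kv‖ ^ 2 * N * (q * Real.sqrt ρ + q ^ 2)) + ENNReal.ofReal (C * ‖kv‖ ^ 2 * q ^ 2) * ∫⁻ X in Literature.MathematicalPhysics.QuantumManyBody.BoseGas.cellN N L, (‖∑ j : Fin N, Complex.exp (Complex.I * ↑(2 * Real.pi / L * ∑ i, (k i : ℝ) * X j i))‖₊ : ENNReal) ^ 2 * (‖Ψ.ψ X‖₊ : ENNReal) ^ 2) → ∃ K : ℝ, 0 < K ∧ ∃ C : ℝ, 0 < C ∧ ∃ ρ₀ : ℝ, 0 < ρ₀ ∧ ∀ ρ : ℝ, 0 < ρ → ρ < ρ₀ → ∀ᶠ n : ℕ in Filter.atTop, ∃ δ : ENNReal, 0 < δ ∧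 ∀ Ψ : Literature.MathematicalPhysics.QuantumManyBody.BoseGas.PeriodicTrialState (n + 1) (Literature.MathematicalPhysics.QuantumManyBody.BoseGas.sideLength ρ (n + 1)), Literature.MathematicalPhysics.QuantumManyBody.BoseGas.periodicEnergy v Ψ ≤ Literature.MathematicalPhysics.QuantumManyBody.BoseGas.periodicGroundStateEnergy v (n + 1) (Literature.MathematicalPhysics.QuantumManyBody.BoseGas.sideLength ρ (n + 1)) + δ → ∀ R : ℝ, K ≤ R * Real.sqrt ρ → R ≤ Literature.MathematicalPhysics.QuantumManyBody.BoseGas.sideLength ρ (n + 1) / 4 → let L : ℝ := Literature.MathematicalPhysics.QuantumManyBody.BoseGas.sideLength ρ (n + 1); (∫⁻ x in Literature.MathematicalPhysics.QuantumManyBody.BoseGas.cell L, ∫⁻ x' in Literature.MathematicalPhysics.QuantumManyBody.BoseGas.cell L, let η : EuclideanSpace ℝ (Fin 3) → ℝ := fun w : EuclideanSpace ℝ (Fin 3) => (Real.pi * R ^ 2)⁻¹ * (Real.sqrt (Real.pi * R ^ 2))⁻¹ * Real.exp (-(‖w‖ ^ 2 / R ^ 2)); let φ : EuclideanSpace ℝ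 (Fin 3) → EuclideanSpace ℝ (Fin 3) := fun y : EuclideanSpace ℝ (Fin 3) => (WithLp.toLp 2 fun i : Fin 3 => (ρ * L ^ 3)⁻¹ * ∑' κ : Fin 3 → ℤ, Real.exp (-(R ^ 2 * (2 * Real.pi / L) ^ 2 * (∑ l, (κ l : ℝ) ^ 2) / 4)) * (L / (2 * Real.pi) * (κ i : ℝ) / (∑ l, (κ l : ℝ) ^ 2)) * (Real.sin (2 * Real.pi / L * ∑ l, (κ l : ℝ) * (y l - x' l)) - Real.sin (2 * Real.pi / L * ∑ l, (κ l : ℝ) * (y l - x l))) : EuclideanSpace ℝ (Fin 3)); let dφ : EuclideanSpace ℝ (Fin 3) → ℝ := fun y : EuclideanSpace ℝ (Fin 3) => (ρ * L ^ 3)⁻¹ * ∑' κ : Fin 3 → ℤ, Real.exp (-(R ^ 2 * (2 * Real.pi / L) ^ 2 * (∑ l, (κ l : ℝ) ^ 2) / 4)) * (Real.cos (2 * Real.pi / L * ∑ l, (κ l : ℝ) * (y l - x' l)) - Real.cos (2 * Real.pi / L * ∑ l, (κ l : ℝ) * (y l - x l))); ∫⁻ Y in Literature.MathematicalPhysics.QuantumManyBody.BoseGas.cellN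 n L, (‖(∫ z : EuclideanSpace ℝ (Fin 3), (η (x - z) : ℂ) * ∑ j : Fin n, (fderiv ℝ Ψ.ψ (Matrix.vecCons z Y) (Pi.single (Fin.succ j) (φ (Y j))) + ((dφ (Y j) / 2 : ℝ) : ℂ) * Ψ.ψ (Matrix.vecCons z Y)))‖₊ : ENNReal) ^ 2) ≤ ENNReal.ofReal (C * Real.sqrt ρ * L ^ 3)

/-- item stmt-AtomisticToContinuum-6510 · support · rank 9 · closed · moot by None · by planner
sources: ReattoChester1967, GavoretNozieres1964, MysliwySeiringer2020, Stringari1995, Summits/AtomisticToContinuum/BoseEinsteinCondensation/Ideas/phonon-transport-fsum.md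
[support] Leg 2 (card T3, 'linear response of the hole'), smeared: for every v, every K > 0 and
every ε > 0 there is ρ₀ > 0 such that for 0 < ρ < ρ₀, all large n, some δ > 0 and every periodic
δ-near-minimiser Ψ there is a radius R with K ≤ R√ρ ≤ 2K such that ∫_x∫_x′∫_Y |Ψ̄_R(x′,Y) −
Ψ̄_R(x,Y) + (G-term of SmearedDipoleCost)|² ≤ εL³, Ψ̄_R(x,Y) = ∫η_R(x−z)Ψ(z,Y)dz: the smeared slice
at x′ equals the first-order dipole transport of the smeared slice at x up to o(1)·L^(3/2) in L².
Honest status: given Leg 1 this is EQUIVALENT (triangle inequality both ways) to complete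
condensation of the window |p| ≲ √ρ/K as ρ → 0; its content is that the RPA identity Σ_jφ(y_j)·δF_j
≈ ½Σ_j[u(y_j−x) − u(y_j−x′)] (the phonon dressing of the tagged boson IS a coherent displacement)
holds in L²(|Ψ|²) at k < 1/R, so only beyond-RPA three-point terms and the O(ρa³) core remain.
[difficulty: XL] -/
@[route_item "route-AtomisticToContinuum-BECPhononTransport"]
def SmearedLinearResponse : Prop :=
  ∀ v : ℝ → ENNReal, Literature.MathematicalPhysics.QuantumManyBody.BoseGas.IsRepulsiveFiniteRange v → ∀ K : ℝ, 0 < K → ∀ ε : ℝ, 0 < ε → ∃ ρ₀ : ℝ, 0 < ρ₀ ∧ ∀ ρ : ℝ, 0 < ρ → ρ < ρ₀ → ∀ᶠ n : ℕ in Filter.atTop, ∃ δ : ENNReal, 0 < δ ∧ ∀ Ψ : Literature.MathematicalPhysics.QuantumManyBody.BoseGas.PeriodicTrialState (n + 1) (Literature.MathematicalPhysics.QuantumManyBody.BoseGas.sideLength ρ (n + 1)), Literature.MathematicalPhysics.QuantumManyBody.BoseGas.periodicEnergy v Ψ ≤ Literature.MathematicalPhysics.QuantumManyBody.BoseGas.periodicGroundStateEnergy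 v (n + 1) (Literature.MathematicalPhysics.QuantumManyBody.BoseGas.sideLength ρ (n + 1)) + δ → ∃ R : ℝ, K ≤ R * Real.sqrt ρ ∧ R * Real.sqrt ρ ≤ 2 * K ∧ let L : ℝ := Literature.MathematicalPhysics.QuantumManyBody.BoseGas.sideLength ρ (n + 1); (∫⁻ x in Literature.MathematicalPhysics.QuantumManyBody.BoseGas.cell L, ∫⁻ x' in Literature.MathematicalPhysics.QuantumManyBody.BoseGas.cell L, let η : EuclideanSpace ℝ (Fin 3) → ℝ := fun w : EuclideanSpace ℝ (Fin 3) => (Real.pi * R ^ 2)⁻¹ * (Real.sqrt (Real.pi * R ^ 2))⁻¹ * Real.exp (-(‖w‖ ^ 2 / R ^ 2)); let φ : EuclideanSpace ℝ (Fin 3) → EuclideanSpace ℝ (Fin 3) := fun y : EuclideanSpace ℝ (Fin 3) => (WithLp.toLp 2 fun i : Fin 3 => (ρ * L ^ 3)⁻¹ * ∑' κ : Fin 3 → ℤ, Real.exp (-(R ^ 2 * (2 * Real.pi / L) ^ 2 * (∑ l, (κ l : ℝ) ^ 2) / 4)) * (L / (2 * Real.pi) * (κ i : ℝ) / (∑ l,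 (κ l : ℝ) ^ 2)) * (Real.sin (2 * Real.pi / L * ∑ l, (κ l : ℝ) * (y l - x' l)) - Real.sin (2 * Real.pi / L * ∑ l, (κ l : ℝ) * (y l - x l))) : EuclideanSpace ℝ (Fin 3)); let dφ : EuclideanSpace ℝ (Fin 3) → ℝ := fun y : EuclideanSpace ℝ (Fin 3) => (ρ * L ^ 3)⁻¹ * ∑' κ : Fin 3 → ℤ, Real.exp (-(R ^ 2 * (2 * Real.pi / L) ^ 2 * (∑ l, (κ l : ℝ) ^ 2) / 4)) * (Real.cos (2 * Real.pi / L * ∑ l, (κ l : ℝ) * (y l - x' l)) - Real.cos (2 * Real.pi / L * ∑ l, (κ l : ℝ) * (y l - x l))); ∫⁻ Y in Literature.MathematicalPhysics.QuantumManyBody.BoseGas.cellN n L, (‖(∫ z : EuclideanSpace ℝ (Fin 3), (η (x' - z) : ℂ) * Ψ.ψ (Matrix.vecCons z Y)) - (∫ z : EuclideanSpace ℝ (Fin 3), (η (x - z) : ℂ) * Ψ.ψ (Matrix.vecCons z Y)) + (∫ z : EuclideanSpace ℝ (Fin 3), (η (x - z) : ℂ) * ∑ j : Fin n, (fderiv ℝ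 Ψ.ψ (Matrix.vecCons z Y) (Pi.single (Fin.succ j) (φ (Y j))) + ((dφ (Y j) / 2 : ℝ) : ℂ) * Ψ.ψ (Matrix.vecCons z Y)))‖₊ : ENNReal) ^ 2) ≤ ENNReal.ofReal (ε * L ^ 3)

/-- item stmt-AtomisticToContinuum-6511 · support · rank 9 · closed · moot by None · by planner
sources: LiebSeiringerSolovejYngvason2005, Richthammer2007
[support] glue of the foreseen split of IRDepletionBound: (Leg-1 body for every v) →
SmearedLinearResponse → IRDepletionBound. Proof: take K, C from Leg 1, apply Leg 2 with that K and ε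
= 1/64, shrink ρ₀ so that C√ρ ≤ 1/64 and 2K/√ρ ≤ L/4 eventually; Minkowski in L²(cell²×cell^n):
∭|Ψ̄_R(x′)−Ψ̄_R(x)|² ≤ (1/8+1/8)²L³; smeared variance identity Σ_(k≠0) e^(−R²p²/2) n_p =
(N/2L³)∭|Ψ̄_R(x′,·)−Ψ̄_R(x,·)|² (Parseval + convolution theorem on the torus, Ψ periodic so the
ℝ³-Gaussian smearing is the periodised one); Gaussian monotonicity with K₀ := 1/(2K): 1_(0<|p|≤K₀√ρ)
≤ e^(1/2) e^(−R²p²/2); hence IR ≤ e^(1/2)(N/2)(1/16) ≤ N/8; index shift n+1 ↔ N under ∀ᶠ.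
[difficulty: M] -/
@[route_item "route-AtomisticToContinuum-BECPhononTransport"]
def TransportToIR : Prop :=
  (∀ v : ℝ → ENNReal, Literature.MathematicalPhysics.QuantumManyBody.BoseGas.IsRepulsiveFiniteRange v → ∃ K : ℝ, 0 < K ∧ ∃ C : ℝ, 0 < C ∧ ∃ ρ₀ : ℝ, 0 < ρ₀ ∧ ∀ ρ : ℝ, 0 < ρ → ρ < ρ₀ → ∀ᶠ n : ℕ in Filter.atTop, ∃ δ : ENNReal, 0 < δ ∧ ∀ Ψ : Literature.MathematicalPhysics.QuantumManyBody.BoseGas.PeriodicTrialState (n + 1) (Literature.MathematicalPhysics.QuantumManyBody.BoseGas.sideLength ρ (n + 1)), Literature.MathematicalPhysics.QuantumManyBody.BoseGas.periodicEnergy v Ψ ≤ Literature.MathematicalPhysics.QuantumManyBody.BoseGas.periodicGroundStateEnergy v (n + 1) (Literature.MathematicalPhysics.QuantumManyBody.BoseGas.sideLength ρ (n + 1)) + δ → ∀ R : ℝ, K ≤ R * Real.sqrt ρ → R ≤ Literature.MathematicalPhysics.QuantumManyBody.BoseGas.sideLength ρ (n + 1) / 4 → let L : ℝ := Literature.MathematicalPhysics.QuantumManyBody.BoseGas.sideLength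 ρ (n + 1); (∫⁻ x in Literature.MathematicalPhysics.QuantumManyBody.BoseGas.cell L, ∫⁻ x' in Literature.MathematicalPhysics.QuantumManyBody.BoseGas.cell L, let η : EuclideanSpace ℝ (Fin 3) → ℝ := fun w : EuclideanSpace ℝ (Fin 3) => (Real.pi * R ^ 2)⁻¹ * (Real.sqrt (Real.pi * R ^ 2))⁻¹ * Real.exp (-(‖w‖ ^ 2 / R ^ 2)); let φ : EuclideanSpace ℝ (Fin 3) → EuclideanSpace ℝ (Fin 3) := fun y : EuclideanSpace ℝ (Fin 3) => (WithLp.toLp 2 fun i : Fin 3 => (ρ * L ^ 3)⁻¹ * ∑' κ : Fin 3 → ℤ, Real.exp (-(R ^ 2 * (2 * Real.pi / L) ^ 2 * (∑ l, (κ l : ℝ) ^ 2) / 4)) * (L / (2 * Real.pi) * (κ i : ℝ) / (∑ l, (κ l : ℝ) ^ 2)) * (Real.sin (2 * Real.pi / L * ∑ l, (κ l : ℝ) * (y l - x' l)) - Real.sin (2 * Real.pi / L * ∑ l, (κ l : ℝ) * (y l - x l))) : EuclideanSpace ℝ (Fin 3)); let dφ : EuclideanSpace ℝ (Fin 3) →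 ℝ := fun y : EuclideanSpace ℝ (Fin 3) => (ρ * L ^ 3)⁻¹ * ∑' κ : Fin 3 → ℤ, Real.exp (-(R ^ 2 * (2 * Real.pi / L) ^ 2 * (∑ l, (κ l : ℝ) ^ 2) / 4)) * (Real.cos (2 * Real.pi / L * ∑ l, (κ l : ℝ) * (y l - x' l)) - Real.cos (2 * Real.pi / L * ∑ l, (κ l : ℝ) * (y l - x l))); ∫⁻ Y in Literature.MathematicalPhysics.QuantumManyBody.BoseGas.cellN n L, (‖(∫ z : EuclideanSpace ℝ (Fin 3), (η (x - z) : ℂ) * ∑ j : Fin n, (fderiv ℝ Ψ.ψ (Matrix.vecCons z Y) (Pi.single (Fin.succ j) (φ (Y j))) + ((dφ (Y j) / 2 : ℝ) : ℂ) * Ψ.ψ (Matrix.vecCons z Y)))‖₊ : ENNReal) ^ 2) ≤ ENNReal.ofReal (C * Real.sqrt ρ * L ^ 3)) → SmearedLinearResponse → IRDepletionBound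

/-- item stmt-AtomisticToContinuum-6512 · support · rank 9 · closed · moot by None · by planner
sources: LiebSeiringerSolovejYngvason2005, PenroseOnsager1956
[support] for every n, L and every periodic trial state Ψ of n+1 particles on the torus of side L:
condensateOccupation (n+1) L Ψ + ((n+1)/(2L³))·∫_x∫_x′∫_Y |Ψ(x′,Y) − Ψ(x,Y)|² = n+1 (x, x′ over the
cell, Y over cell^n). Proof: ⟨f,(1−P₀)f⟩ = ‖f‖² − L⁻³|∫f|² = (2L³)⁻¹∬|f(x)−f(x′)|² for f = Ψ(·,Y) ∈
L²(cell), Fubini over Y, normalisation via the measure-preserving split Config(n+1) ≅ Space × Config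
n (Matrix.vecCons). The identity behind the whole transport reading (depletion = two-point slice
variance = N·(1 − mean Bhattacharyya affinity of the Palm measures) for Ψ ≥ 0); provable now.
[difficulty: provable-now] -/
@[route_item "route-AtomisticToContinuum-BECPhononTransport"]
def DepletionVarianceIdentity : Prop :=
  ∀ (n : ℕ) (L : ℝ) (Ψ : Literature.MathematicalPhysics.QuantumManyBody.BoseGas.PeriodicTrialState (n + 1) L), Literature.MathematicalPhysics.QuantumManyBody.BoseGas.condensateOccupation (n + 1) L Ψ.ψ + ENNReal.ofReal ((n + 1) / (2 * L ^ 3)) * (∫⁻ x in Literature.MathematicalPhysics.QuantumManyBody.BoseGas.cell L, ∫⁻ x' in Literature.MathematicalPhysics.QuantumManyBody.BoseGas.cell L, ∫⁻ Y in Literature.MathematicalPhysics.QuantumManyBody.BoseGas.cellN n L, (‖Ψ.ψ (Matrix.vecCons x' Y) - Ψ.ψ (Matrix.vecCons x Y)‖₊ : ENNReal) ^ 2) = ((n + 1 : ℕ) : ENNReal)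

-- TODO item stmt-AtomisticToContinuum-6513 · assembly · rank 1 · closed · moot by None · by planner — BLOCKED: missing decl(s) BoundaryTransferWeak; restate via `ledger route edit` once they land:
--   def Assembly : Prop := IRDepletionBound → UVDepletionBound → SplitToPeriodicBEC → BoundaryTransferWeak → Literature.MathematicalPhysics.QuantumManyBody.BoseGas.BoseEinsteinCondensation

end Summit.AtomisticToContinuum.BoseEinsteinCondensation.Theses.BECPhononTransport
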